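import Mathlib
import Literature.Analysis.ValidatedNumerics.ConeAlgebraEvaluation
import Literature.Analysis.ValidatedNumerics.ConeAlgebraSemilinearClosing
import HarnessLib

/-!
# The cone-algebra Dirichlet inverse produces functions vanishing on the unit circle

Topic `Literature/Analysis/ValidatedNumerics`.  Semantics of the operator `Δ_D⁻¹ = ConeSemilinear.dirInv`
of the certnum F2 (B″)/(B-SL) certificates (`ConeAlgebraSemilinearClosing.lean`), read through the
evaluation homomorphism `ConeEval.eval` (`ConeAlgebraEvaluation.lean`): for EVERY `u` in the cone Wiener
algebra `W = ℓ¹_ϱ(ζ^aζ̄^b)` (`ϱ ≥ 1`) and every `ζ` in the closed unit disk,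

* `eval_dirInv_eq_tsum_colFun` — **column representation** `(Δ_D⁻¹u)(ζ) = Σ_m u_m · w_m(ζ)`, where
  `w_m = colFun m` is the function of column `m = (a,b)` of the kernel,
  `w_m(ζ) = (ζ^{a+1}ζ̄^{b+1} − ζ^{a−b})/(4(a+1)(b+1))` (`b ≤ a`; `ζ̄^{b−a}` otherwise) (`colFun_eq`) — an
  exchange of two absolutely convergent sums (column sums `Σ_k |Δ_D⁻¹(k,m)| = 1/(2(a+1)(b+1)) ≤ 1/2`);
* `colFun_eq_zero_of_norm_eq_one` — each `w_m` vanishes on `|ζ| = 1`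
  (`ConeMonomial.monomial_boundary(')`), hence
* `eval_dirInv_eq_zero_of_norm_eq_one` — **`(Δ_D⁻¹u)(ζ) = 0` for `|ζ| = 1`**: the zero Dirichlet datum of
  the certificate's solution operator holds for the represented function of every element of `W`, in
  particular for the (not finitely supported) true zero `x⋆` of `ConeSemilinear.cone_existsUnique_zero_of_semilin`:
  `x⋆ = Δ_D⁻¹(v x⋆ + Σ c_k x⋆^k) + g` gives `x⋆(ζ) = g(ζ)` on the unit circle (`eval_zero_boundary`).

## Sources

[ArioliKoch2019] G. Arioli, H. Koch, Nonlinear Anal. 179 (2019): §2 Lemma 2.1 (the termwise inverse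
Dirichlet Laplacian: each basis image vanishes on `∂Ω` because `zz̄ = 1` there, eq. (2.6)), §3 Prop. 3.2
(`Δ⁻¹` bounded on the algebra), eq. (1.4) (p. 4) (`G(u) = (−Δ)⁻¹(w f′(u))`) and §4 Lemma 4.1 (pp. 9–10) (so fixed points satisfy the
boundary condition).  Monomial version as in `ConeMonomialLaplacian.lean`.

## What is NOT covered

The interior statement `Δ((Δ_D⁻¹u)∘eval) = u∘eval` on the OPEN disk for infinite families (termwise second
derivatives; needs `ϱ > 1` and the derivative dictionary) — column by column it is
`ConeMonomial.lapRI_monomial`; float model.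

## Provenance

AI-produced formalisation (cell certnum, seat certnum-ode-2, 2026-08-27).
-/

set_option autoImplicit false

open scoped BigOperators
open Complex

noncomputable section

namespace Literature.Analysis.ValidatedNumerics

namespace ConeEval

open WeightedSeq WienerAlgebra ConeMonomial ConeSemilinear

variable {ϱ : ℝ}

/-! ### The column functions of `Δ_D⁻¹` -/

/-- The function of column `m` of the Dirichlet-inverse kernel: `w_m(ζ) = Σ_k Δ_D⁻¹(k,m) ζ^{k₀} ζ̄^{k₁}`
(a two-term sum). [cite: ArioliKoch2019, §2 Lemma 2.1 (termwise inverse)] -/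
def colFun (m : Fin 2 →₀ ℕ) (ζ : ℂ) : ℂ := ∑' k, (dirKer k m : ℂ) * mono k ζ

/-- The exponent with prescribed coordinates `(a,b)` (inverse of `ConeSemilinear.idx`).
[cite: ArioliKoch2019, §3 eq. (3.1)] -/
def ofPair (p : ℕ × ℕ) : Fin 2 →₀ ℕ := idx.symm p

/-- [cite: ArioliKoch2019, §3 eq. (3.1)] -/
@[simp] theorem idx_ofPair (p : ℕ × ℕ) : idx (ofPair p) = p := idx.apply_symm_apply p

/-- [cite: ArioliKoch2019, §3 eq. (3.1)] -/
theorem mono_ofPair (p : ℕ × ℕ) (ζ : ℂ) : mono (ofPair p) ζ = monomial p.1 p.2 ζ := by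
  have h1 : (ofPair p) 0 = p.1 := congrArg Prod.fst (idx_ofPair p)
  have h2 : (ofPair p) 1 = p.2 := congrArg Prod.snd (idx_ofPair p)
  rw [mono, h1, h2]

/-- The kernel column `m` vanishes off the two exponents `ofPair (raise (idx m))`, `ofPair (harmIndex (idx m))`.
[cite: ArioliKoch2019, §2 Lemma 2.1] -/
theorem dirKer_eq_zero_of_not_mem {k m : Fin 2 →₀ ℕ}
    (hk : k ∉ ({ofPair (raise (idx m)), ofPair (harmIndex (idx m))} : Finset (Fin 2 →₀ ℕ))) :
    dirKer k m = 0 := by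
  rw [Finset.mem_insert, Finset.mem_singleton, not_or] at hk
  refine dirichletInvKer_eq_zero ?_ ?_
  · intro h; exact hk.1 (by rw [ofPair, ← h, Equiv.symm_apply_apply])
  · intro h; exact hk.2 (by rw [ofPair, ← h, Equiv.symm_apply_apply])

/-- The two support exponents are distinct. [cite: ArioliKoch2019, §2 Lemma 2.1] -/
theorem ofPair_raise_ne_ofPair_harm (m : Fin 2 →₀ ℕ) :
    ofPair (raise (idx m)) ≠ ofPair (harmIndex (idx m)) := fun h =>
  raise_ne_harmIndex (idx m) (idx.symm.injective h)

/-- **Closed form of the column function:**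
`w_m(ζ) = (ζ^{a+1} ζ̄^{b+1} − M_{harmIndex(a,b)}(ζ)) / (4(a+1)(b+1))`, `(a,b) = idx m`.
[cite: ArioliKoch2019, §2 Lemma 2.1 (Δ⁻¹ on the basis, monomial version)] -/
theorem colFun_eq (m : Fin 2 →₀ ℕ) (ζ : ℂ) :
    colFun m ζ = (invFactor (idx m) : ℂ) *
      (monomial ((idx m).1 + 1) ((idx m).2 + 1) ζ
        - monomial (harmIndex (idx m)).1 (harmIndex (idx m)).2 ζ) := by
  unfold colFun
  rw [tsum_eq_sum (s := {ofPair (raise (idx m)), ofPair (harmIndex (idx m))})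
      (fun k hk => by rw [dirKer_eq_zero_of_not_mem hk, Complex.ofReal_zero, zero_mul]),
    Finset.sum_pair (ofPair_raise_ne_ofPair_harm m)]
  unfold dirKer
  rw [idx_ofPair, idx_ofPair, dirichletInvKer_apply_raise, dirichletInvKer_apply_harm, mono_ofPair,
    mono_ofPair, Complex.ofReal_neg]
  unfold raise
  ring

/-- **Each column function vanishes on the unit circle** (`ζζ̄ = 1` there).
[cite: ArioliKoch2019, §2 Lemma 2.1 and eq. (2.6) (the basis images vanish on ∂Ω)] -/
theorem colFun_eq_zero_of_norm_eq_one (m : Fin 2 →₀ ℕ) {ζ : ℂ} (hζ : ‖ζ‖ = 1) : colFun m ζ = 0 := by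
  rw [colFun_eq]
  unfold harmIndex monomial
  split_ifs with h
  · simp only
    rw [monomial_boundary hζ h, pow_zero, mul_one, sub_self, mul_zero]
  · simp only
    rw [monomial_boundary' hζ (le_of_lt (not_le.1 h)), pow_zero, one_mul, sub_self, mul_zero]

/-- The kernel entries are bounded by the column factor: `|Δ_D⁻¹(k,m)| ≤ 1/(4(a+1)(b+1))`.
[cite: ArioliKoch2019, §2 Lemma 2.1] -/
theorem abs_dirKer_le (k m : Fin 2 →₀ ℕ) : |dirKer k m| ≤ invFactor (idx m) := by
  have hf := (invFactor_pos (idx m)).le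
  unfold dirKer dirichletInvKer
  split_ifs
  · rw [sub_self, abs_zero]; exact hf
  · rw [sub_zero, abs_of_nonneg hf]
  · rw [zero_sub, abs_neg, abs_of_nonneg hf]
  · rw [sub_zero, abs_zero]; exact hf

/-- `1/(4(a+1)(b+1)) ≤ 1/4`. [cite: ArioliKoch2019, §2 Lemma 2.1] -/
theorem invFactor_le (p : ℕ × ℕ) : invFactor p ≤ 1 / 4 := by
  unfold invFactor
  rw [div_le_div_iff₀ (by positivity) (by norm_num)]
  have ha : (0 : ℝ) ≤ p.1 := Nat.cast_nonneg _
  have hb : (0 : ℝ) ≤ p.2 := Nat.cast_nonneg _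
  nlinarith [mul_nonneg ha hb]

/-- The absolute column sum of the kernel: `Σ_k |Δ_D⁻¹(k,m)| ≤ 1/2` (two entries of size `invFactor ≤ 1/4`).
[cite: ArioliKoch2019, §2 Lemma 2.1] -/
theorem summable_abs_dirKer_col (m : Fin 2 →₀ ℕ) :
    Summable (fun k => |dirKer k m|) ∧ ∑' k, |dirKer k m| ≤ 1 / 2 := by
  have hz : ∀ k, k ∉ ({ofPair (raise (idx m)), ofPair (harmIndex (idx m))} : Finset (Fin 2 →₀ ℕ)) →
      |dirKer k m| = 0 := fun k hk => by rw [dirKer_eq_zero_of_not_mem hk, abs_zero]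
  refine ⟨summable_of_ne_finset_zero hz, ?_⟩
  rw [tsum_eq_sum hz, Finset.sum_pair (ofPair_raise_ne_ofPair_harm m)]
  have h1 := (abs_dirKer_le (ofPair (raise (idx m))) m).trans (invFactor_le (idx m))
  have h2 := (abs_dirKer_le (ofPair (harmIndex (idx m))) m).trans (invFactor_le (idx m))
  linarith

/-! ### Exchange of summations and the boundary values of `Δ_D⁻¹ u` -/

/-- The double family `(m,k) ↦ Δ_D⁻¹(k,m) u_m ζ^{k₀}ζ̄^{k₁}` is absolutely summable on the closed disk.
[cite: ArioliKoch2019, §3 Prop. 3.2 (Δ⁻¹ bounded on the algebra)] -/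
theorem summable_uncurry (hϱ : 1 ≤ ϱ) (u : Wiener (coneSubmultWeight hϱ)) {ζ : ℂ} (hζ : ‖ζ‖ ≤ 1) :
    Summable (Function.uncurry fun m k => (dirKer k m : ℂ) * (cf u m : ℂ) * mono k ζ) := by
  -- dominate by g (m,k) = |K k m| |u_m|
  have hdom : ∀ p : (Fin 2 →₀ ℕ) × (Fin 2 →₀ ℕ),
      ‖Function.uncurry (fun m k => (dirKer k m : ℂ) * (cf u m : ℂ) * mono k ζ) p‖
        ≤ |dirKer p.2 p.1| * |cf u p.1| := by
    rintro ⟨m, k⟩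
    simp only [Function.uncurry_apply_pair]
    rw [norm_mul, norm_mul, Complex.norm_real, Complex.norm_real, Real.norm_eq_abs, Real.norm_eq_abs]
    have hm : ‖mono k ζ‖ ≤ 1 := by
      rw [norm_mono]; exact pow_le_one₀ (norm_nonneg _) hζ
    calc |dirKer k m| * |cf u m| * ‖mono k ζ‖ ≤ |dirKer k m| * |cf u m| * 1 :=
          mul_le_mul_of_nonneg_left hm (mul_nonneg (abs_nonneg _) (abs_nonneg _))
      _ = |dirKer k m| * |cf u m| := mul_one _
  refine Summable.of_norm_bounded ?_ hdom
  have hnn : 0 ≤ fun p : (Fin 2 →₀ ℕ) × (Fin 2 →₀ ℕ) => |dirKer p.2 p.1| * |cf u p.1| :=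
    fun p => mul_nonneg (abs_nonneg _) (abs_nonneg _)
  refine (summable_prod_of_nonneg hnn).2 ⟨fun m => ?_, ?_⟩
  · exact ((summable_abs_dirKer_col m).1.mul_right (|cf u m|))
  · simp only
    have hle : ∀ m, ∑' k, |dirKer k m| * |cf u m| ≤ |cf u m| * (coneSubmultWeight hϱ).toFun m := by
      intro m
      rw [tsum_mul_right]
      have hw : 1 ≤ (coneSubmultWeight hϱ).toFun m := by
        rw [coneSubmultWeight_apply]; exact one_le_pow₀ hϱ
      have hc : 0 ≤ |cf u m| := abs_nonneg _
      nlinarith [(summable_abs_dirKer_col m).2]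
    refine Summable.of_nonneg_of_le (fun m => ?_) hle (mem_cf u)
    exact tsum_nonneg fun _ => mul_nonneg (abs_nonneg _) (abs_nonneg _)

/-- **Column representation of `(Δ_D⁻¹u)(ζ)`**: `(Δ_D⁻¹u)(ζ) = Σ_m u_m · w_m(ζ)` on the closed unit disk
(exchange of the two sums). [cite: ArioliKoch2019, §2 Lemma 2.1 with §3 Prop. 3.2] -/
theorem eval_dirInv_eq_tsum_colFun (hϱ : 1 ≤ ϱ) (u : Wiener (coneSubmultWeight hϱ)) {ζ : ℂ}
    (hζ : ‖ζ‖ ≤ 1) :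
    eval hϱ (dirInv hϱ u) ζ = ∑' m, (cf u m : ℂ) * colFun m ζ := by
  -- coefficients of Δ_D⁻¹ u as real series, cast to ℂ
  have hcf : ∀ k, (cf (dirInv hϱ u) k : ℂ) = ∑' m, (dirKer k m : ℂ) * (cf u m : ℂ) := by
    intro k
    have h1 : cf (dirInv hϱ u) k = apply dirKer (cf u) k := coeff_dirInv hϱ u k
    rw [h1, apply, Complex.ofReal_tsum]
    exact tsum_congr fun m => by rw [Complex.ofReal_mul]
  unfold eval
  have e1 : ∀ k, (cf (dirInv hϱ u) k : ℂ) * mono k ζ = ∑' m, (dirKer k m : ℂ) * (cf u m : ℂ) * mono k ζ := by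
    intro k; rw [hcf k, tsum_mul_right]
  rw [tsum_congr e1]
  -- swap
  rw [(summable_uncurry hϱ u hζ).tsum_comm]
  refine tsum_congr fun m => ?_
  unfold colFun
  rw [← tsum_mul_left]
  exact tsum_congr fun k => by ring

/-- **`(Δ_D⁻¹u)(ζ) = 0` on the unit circle**, for every `u ∈ W`.
[cite: ArioliKoch2019, §2 Lemma 2.1 / eq. (2.6) (images vanish on ∂Ω); eq. (1.4) (p. 4) and §4 Lemma 4.1 (pp. 9–10)] -/
theorem eval_dirInv_eq_zero_of_norm_eq_one (hϱ : 1 ≤ ϱ) (u : Wiener (coneSubmultWeight hϱ)) {ζ : ℂ}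
    (hζ : ‖ζ‖ = 1) : eval hϱ (dirInv hϱ u) ζ = 0 := by
  rw [eval_dirInv_eq_tsum_colFun hϱ u hζ.le]
  simp [colFun_eq_zero_of_norm_eq_one _ hζ]

/-- **Boundary values of the certificate's zero:** if `x = Δ_D⁻¹ y + g` in `W` (as for a zero of
`semilinMap (dirInv hϱ) v c m g`, with `y = v x + Σ c_k x^k`), then `x(ζ) = g(ζ)` for `|ζ| = 1`.
[cite: ArioliKoch2019, eq. (1.4) (p. 4) and §4 Lemma 4.1 (pp. 9–10) (fixed points of G solve the Dirichlet problem)] -/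
theorem eval_zero_boundary (hϱ : 1 ≤ ϱ) {x y g : Wiener (coneSubmultWeight hϱ)}
    (hx : x = dirInv hϱ y + g) {ζ : ℂ} (hζ : ‖ζ‖ = 1) : eval hϱ x ζ = eval hϱ g ζ := by
  rw [hx, eval_add hϱ _ _ hζ.le, eval_dirInv_eq_zero_of_norm_eq_one hϱ y hζ, zero_add]

/-- The same for a zero of the semilinear map: `semilinMap (dirInv hϱ) v c m g x = 0 ⇒ x(ζ) = g(ζ)` on
`|ζ| = 1`. [cite: ArioliKoch2019, eq. (1.4) (p. 4) and §4 Lemma 4.1 (pp. 9–10)] -/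
theorem eval_eq_of_semilinMap_eq_zero (hϱ : 1 ≤ ϱ) {v g x : Wiener (coneSubmultWeight hϱ)}
    {c : ℕ → Wiener (coneSubmultWeight hϱ)} {m : ℕ}
    (hx : Literature.Analysis.Calculus.PolynomialNonlinearity.semilinMap (dirInv hϱ) v c m g x = 0)
    {ζ : ℂ} (hζ : ‖ζ‖ = 1) : eval hϱ x ζ = eval hϱ g ζ := by
  have h : x = dirInv hϱ (v * x + Literature.Analysis.Calculus.PolynomialNonlinearity.polyMap c m x) + g := by
    unfold Literature.Analysis.Calculus.PolynomialNonlinearity.semilinMap at hx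
    have := sub_eq_zero.1 hx
    rw [← this]
    abel
  exact eval_zero_boundary hϱ h hζ

end ConeEval

end Literature.Analysis.ValidatedNumerics
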